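import Literature.MathematicalPhysics.QuantumFieldTheory.BalabanImbrieJaffe1984to88.BIJ88ChiSlotDsetBound309
import Literature.MathematicalPhysics.QuantumFieldTheory.BalabanImbrieJaffe1984to88.BIJ88TrainTermBound307
import Literature.MathematicalPhysics.QuantumFieldTheory.BalabanImbrieJaffe1984to88.BIJ88CubeProductDset306
import Literature.MathematicalPhysics.QuantumFieldTheory.BalabanImbrieJaffe1984to88.BIJ88DsetNormBound306

/-!
# `BalabanImbrieJaffe1984to88.BIJ88CubeSlotCosts309` — T. Bałaban, J. Imbrie, A. Jaffe, *Effective action and cluster properties of the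
abelian Higgs model*, Commun. Math. Phys. **114** (1988) 257–315 [BalabanImbrieJaffe1988]: p. 307 [PDF 51] (Sect. 5.13: *"Functional
derivatives hitting χ-factors … are supported at |A^{(k)″}| ≥ cp(e_k) … Functional derivatives hitting e^{−V^{(k)}(Y)} yield factors
e^β(L^kε/ε₀)^{1/4−α} … (Factorials can be produced when many functional derivatives hit the same object …)"*) and pp. 308–309 [PDF 52–53]
((5.14.3)–(5.14.4): *"(d/dt)_γ acts only on the t before a particular term V^{(k)}(Y) in Ṽ^{(k)} or in a particular χ-factor"*, *"Each d/dt
derivative produces a factor …"*) — **THE COST OF ALL THE LEGS LANDING IN ONE CUBE: A SUM OVER SLOT ASSIGNMENTS OF PRODUCTS OF SLOT COSTS,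
WITH THE JOINT SHELL INDICATOR OF THE CUBE'S `t`-DIFFERENTIATED χ-SLOTS KEPT**.

This is the per-cube factor of `BIJ88CubeProductDset306.dset_obs_fD_uD_eq_prod` (the iterated coordinate derivative of the located cube product
is the product over the cubes `□_i ⊂ X` of `∂_{q_{D_i}}[fD_K(□_i) ∘ ext]`), estimated:
* `fD_uD_ext_eq` — reading the cube's derivative observable on the fields of `X` = the same observable for the slot data composed with `ext`
  (`BIJ88SlotMomentsGauss308.slotFactor_ext`), so that `BIJ88ProductRuleAllOrders306.dset_fD_uD_apply` (all-orders Leibniz over the cube's slots)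
  applies on the carrier `{x // blk x ∈ X}` (`dset_fD_uD_ext_apply`);
* **`abs_dset_fD_uD_ext_le_of_slot_costs`** — if every slot factor `u_{τ,m}` obeys a cost bound `|∂_{q_{D′}} u_{τ,m}(φ)| ≤ cst τ m D′ · w τ m φ`
  with weights `0 ≤ w ≤ 1` (χ-slot: `w` = its shell indicator, `BIJ88ChiSlotDsetBound309`; `V`-slot: `w = 1`, the all-orders letter of
  r16's typing gap #1 in the `dset` form of `BIJ88DsetNormBound306`), then for ANY selection `P` of the cube's slots
  `|∂_{q_D}[fD_K(□_i)∘ext](φ)| ≤ (Σ_{g} Π_{τ⊂□_i} cst τ m_τ (D∩g⁻¹τ)) · Π_{τ⊂□_i, P τ} w τ m_τ φ` (`m_τ` = number of `t`-derivatives `K` puts on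
  `τ`) — `BIJ88TrainTermBound307.abs_prod_le_prod_mul_prod_filter` under the assignment sum;
* **`abs_dset_fD_uD_ext_le_indicator`** — the same with `w` = shell indicators on the χ-slots and `P` = "χ-slot with `m_τ ≥ 1`": the bound is
  `(Σ_g Π_τ cst) · 𝟙{joint shell of the t-differentiated χ-slots of □_i}(φ)`, the hypothesis shape of
  `BIJ88GaussShellInterpolated309.abs_gexp_prec_le_shell` — one Gaussian shell factor per `t`-differentiated χ-slot, WHATEVER the legs do (the
  `θ^{|H|}` of the located (5.14.4)); extra legs only change the constant (print's *"factorials"*);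
* `abs_dset_uD_inr_ext_le_of_letter` — the `V`-slot cost hypothesis discharged from the all-orders letter `‖Dⁿ[u_{Y,m}∘ext]‖ ≤ K_Y(m,n)`
  (r16's «§f typing gap #1», carried as a named hypothesis) by `BIJ88DsetNormBound306.abs_dset_single_le_of_bound`; the χ-slot cost hypothesis is
  `BIJ88ChiSlotDsetBound309.exists_abs_dset_uD_inl_le`.

statement-level skeleton of published theorems with citation tags; proofs where landed; nothing here is a claim about the Yang–Mills mass gap

PDF held: `paper:balaban1988-cmp114-bij-abelian-higgs-effective-action` (journal page = PDF page + 256); pages re-read this session as text: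
PDF 51 (p. 307) L8–18, PDF 52–53 (pp. 308–309).

CITATION HEADER (lean-in-tree rule).  Part of the lit-balaban TYPED SKELETON (HOME `run/shared/lean/pub/lit-balaban/`), Phase 2, seat p36
(gen 21, unit `lit-balaban-p36`); rows **C2.Eq5.14.3-5.14.4** (member: §f estimate E4c — the per-cube integrand bound of the assembly) and
C2.Eq5.13.3-5.13.4 (member) of `HOME/lit-balaban-r16/ROWS-C2-part2.md` (owner r16, referee ref-5).  Theorem-only; no definitions, no `Prop`
facts; axioms standard.
HONEST SCOPE.  The slot costs enter as hypotheses in the displayed shape (χ-slots: discharged by `BIJ88ChiSlotDsetBound309.exists_abs_dset_uD_inl_le`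
for linear slot fields; `V`-slots: the named all-orders letter); which products of constants are small is the θ-bookkeeping of the assembly, not here.
-/

namespace Literature.MathematicalPhysics.QuantumFieldTheory.BalabanImbrieJaffe1984to88.BIJ88CubeSlotCosts309

open Finset
open scoped BigOperators
open BIJ88Sect5Statements (CutoffProfile)
open BIJ88WickSourceSmooth305 (dset)
open BIJ88SmoothFactors5133 (CbInf)
open BIJ88Expansion5143Gauss (fD)
open BIJ88SlotMomentsGauss308 (uD slotFactor_ext)
open BIJ88PolymerRep5134Gauss (ext)
open BIJ88ProductRuleAllOrders306 (dset_fD_uD_apply mem_asg)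
open BIJ88TrainTermBound307 (abs_prod_le_prod_mul_prod_filter prod_indicator_one_eq_indicator_iInter indicator_one_mem_Icc
  abs_sum_le_sum_mul_indicator)

variable {α I : Type} [Fintype α] [DecidableEq α] [DecidableEq I] (blk : α → I) (X : Finset I)
variable {κ : Type} [LinearOrder κ]
variable (χ : CutoffProfile) {ι υ : Type} [DecidableEq ι] [DecidableEq υ] (p : ℝ) {ek t : ℝ} (B : Finset ι)
  {Φ : ι → (α → ℝ) → ℝ} {c : ι → ℝ} (Ys : Finset υ) {V : υ → (α → ℝ) → ℝ} (cube : ↥B ⊕ ↥Ys → I) {L : Type*} (γ : L → ↥B ⊕ ↥Ys)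

omit [Fintype α] [DecidableEq α] [LinearOrder κ] in
/-- **reading a cube's derivative observable on the fields of `X`** = the derivative observable of the slot data composed with the extension map
(`slotFactor_ext`). [cite: BalabanImbrieJaffe1988, (5.14.3) p.309] -/
theorem fD_uD_ext_eq (ek t : ℝ) (K : Finset L) (i : I) :
    (fun ψ : {x : α // blk x ∈ X} → ℝ => fD (uD χ p ek B Φ c Ys V t) cube γ K i (ext blk X ψ)) =
      fD (uD χ p ek B (fun b ψ => Φ b (ext blk X ψ)) c Ys (fun Y ψ => V Y (ext blk X ψ)) t) cube γ K i := by
  funext ψ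
  simp only [fD]
  exact prod_congr rfl fun τ _ => by simp only [uD, slotFactor_ext]

/-- **THE ASSIGNMENT SUM OF ONE CUBE ON THE FIELDS OF `X`**: `∂_{q_D}[fD_K(□_i)∘ext](φ) = Σ_g Π_{τ⊂□_i} ∂_{q_{D∩g⁻¹τ}}[u_{τ,m_τ}∘ext](φ)`
(`BIJ88ProductRuleAllOrders306.dset_fD_uD_apply` on the carrier `{x // blk x ∈ X}`; linear `Φ_b`, `c_b ≠ 0`, `V_Y ∈ C_b^∞`, `t` on the branch).
[cite: BalabanImbrieJaffe1988, §5.13 p.307, (5.14.3) p.308–309] -/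
theorem dset_fD_uD_ext_apply [Fintype κ] (hek : 0 < ek) (ht : 0 < t) (h1 : t * ek < 1) (hΦ : ∀ b ∈ B, IsLinearMap ℝ (Φ b))
    (hc : ∀ b ∈ B, c b ≠ 0) (hV : ∀ Y ∈ Ys, CbInf (V Y)) (K : Finset L) (i : I) (τ₀ : ↥B ⊕ ↥Ys)
    (q : κ → {x : α // blk x ∈ X}) (D : Finset κ) (φ : {x : α // blk x ∈ X} → ℝ) :
    dset (fun j => Pi.single (q j) (1 : ℝ)) D (fun ψ => fD (uD χ p ek B Φ c Ys V t) cube γ K i (ext blk X ψ)) φ =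
      ∑ g ∈ Fintype.piFinset (fun j => if j ∈ D then univ.filter (fun τ => cube τ = i) else {τ₀}),
        ∏ τ ∈ univ.filter (fun τ => cube τ = i),
          dset (fun j => Pi.single (q j) (1 : ℝ)) (D.filter fun j => g j = τ)
            (fun ψ => uD χ p ek B Φ c Ys V t τ (K.filter fun j => γ j = τ).card (ext blk X ψ)) φ := by
  rw [fD_uD_ext_eq]
  have hΦ' : ∀ b ∈ B, IsLinearMap ℝ fun ψ : {x : α // blk x ∈ X} → ℝ => Φ b (ext blk X ψ) :=
    fun b hb => BIJ88ChiSlotDsetBound309.isLinearMap_slot_ext blk X (hΦ b hb)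
  have hV' : ∀ Y ∈ Ys, CbInf fun ψ : {x : α // blk x ∈ X} → ℝ => V Y (ext blk X ψ) :=
    fun Y hY => BIJ88CubeProductDset306.cbInf_comp_ext blk (fun _ : I => V Y) X (i := i) (hV Y hY)
  rw [dset_fD_uD_apply χ p B Ys cube γ hek ht h1 hΦ' hc hV' K i τ₀ _ D φ]
  refine sum_congr rfl fun g _ => prod_congr rfl fun τ _ => ?_
  congr 1

/-- **THE CUBE COST FROM SLOT COSTS**: if every slot factor obeys `|∂_{q_{D′}}[u_{τ,m}∘ext](φ)| ≤ cst τ m D′ · w τ m φ` with `0 ≤ cst` and weights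
`0 ≤ w ≤ 1`, then for any selection `P` of slots
`|∂_{q_D}[fD_K(□_i)∘ext](φ)| ≤ (Σ_g Π_{τ⊂□_i} cst τ m_τ (D∩g⁻¹τ)) · Π_{τ⊂□_i, P τ} w τ m_τ φ`, `m_τ = #{k ∈ K : γ k = τ}`.
[cite: BalabanImbrieJaffe1988, §5.13 p.307, (5.14.3)–(5.14.4) p.309] -/
theorem abs_dset_fD_uD_ext_le_of_slot_costs [Fintype κ] (hek : 0 < ek) (ht : 0 < t) (h1 : t * ek < 1)
    (hΦ : ∀ b ∈ B, IsLinearMap ℝ (Φ b)) (hc : ∀ b ∈ B, c b ≠ 0) (hV : ∀ Y ∈ Ys, CbInf (V Y)) (K : Finset L) (i : I) (τ₀ : ↥B ⊕ ↥Ys)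
    (q : κ → {x : α // blk x ∈ X}) (D : Finset κ) {cst : ↥B ⊕ ↥Ys → ℕ → Finset κ → ℝ}
    {w : ↥B ⊕ ↥Ys → ℕ → ({x : α // blk x ∈ X} → ℝ) → ℝ} (hcst : ∀ τ m D', 0 ≤ cst τ m D') (hw0 : ∀ τ m φ, 0 ≤ w τ m φ)
    (hw1 : ∀ τ m φ, w τ m φ ≤ 1)
    (hcost : ∀ (τ : ↥B ⊕ ↥Ys) (m : ℕ) (D' : Finset κ) (φ : {x : α // blk x ∈ X} → ℝ),
      |dset (fun j => Pi.single (q j) (1 : ℝ)) D' (fun ψ => uD χ p ek B Φ c Ys V t τ m (ext blk X ψ)) φ| ≤ cst τ m D' * w τ m φ)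
    (P : ↥B ⊕ ↥Ys → Prop) [DecidablePred P] (φ : {x : α // blk x ∈ X} → ℝ) :
    |dset (fun j => Pi.single (q j) (1 : ℝ)) D (fun ψ => fD (uD χ p ek B Φ c Ys V t) cube γ K i (ext blk X ψ)) φ| ≤
      (∑ g ∈ Fintype.piFinset (fun j => if j ∈ D then univ.filter (fun τ => cube τ = i) else {τ₀}),
          ∏ τ ∈ univ.filter (fun τ => cube τ = i), cst τ (K.filter fun j => γ j = τ).card (D.filter fun j => g j = τ)) *
        ∏ τ ∈ (univ.filter (fun τ => cube τ = i)).filter P, w τ (K.filter fun j => γ j = τ).card φ := by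
  rw [dset_fD_uD_ext_apply blk X χ p B Ys cube γ hek ht h1 hΦ hc hV K i τ₀ q D φ, sum_mul]
  refine (abs_sum_le_sum_abs _ _).trans (sum_le_sum fun g _ => ?_)
  exact abs_prod_le_prod_mul_prod_filter (univ.filter fun τ => cube τ = i) P
    (a := fun τ φ => dset (fun j => Pi.single (q j) (1 : ℝ)) (D.filter fun j => g j = τ)
      (fun ψ => uD χ p ek B Φ c Ys V t τ (K.filter fun j => γ j = τ).card (ext blk X ψ)) φ)
    (w := fun τ φ => w τ (K.filter fun j => γ j = τ).card φ)
    (c := fun τ => cst τ (K.filter fun j => γ j = τ).card (D.filter fun j => g j = τ))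
    (fun τ _ => hcst _ _ _) (fun τ _ φ => hw0 _ _ _) (fun τ _ φ => hw1 _ _ _) (fun τ _ φ => hcost _ _ _ _) φ

/-- **… WITH THE JOINT SHELL INDICATOR OF THE `t`-DIFFERENTIATED χ-SLOTS KEPT**: χ-slot costs `cst · 𝟙{a_b ≤ |Φ_b(ext φ)| ≤ a′_b}` (any `m`,
any legs) and `V`-slot costs `cst` (weight `1`) give
`|∂_{q_D}[fD_K(□_i)∘ext](φ)| ≤ (Σ_g Π_{τ⊂□_i} cst τ m_τ (D∩g⁻¹τ)) · 𝟙{a_b ≤ |Φ_b(ext φ)| ≤ a′_b for every χ-slot b ⊂ □_i with m_b ≥ 1}(φ)` — the shape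
`BIJ88GaussShellInterpolated309.abs_gexp_prec_le_shell` integrates (the upper shell bound may be dropped there by monotonicity).
[cite: BalabanImbrieJaffe1988, §5.13 p.307, (5.14.3)–(5.14.4) p.309] -/
theorem abs_dset_fD_uD_ext_le_indicator [Fintype κ] (hek : 0 < ek) (ht : 0 < t) (h1 : t * ek < 1)
    (hΦ : ∀ b ∈ B, IsLinearMap ℝ (Φ b)) (hc : ∀ b ∈ B, c b ≠ 0) (hV : ∀ Y ∈ Ys, CbInf (V Y)) (K : Finset L) (i : I) (τ₀ : ↥B ⊕ ↥Ys)
    (q : κ → {x : α // blk x ∈ X}) (D : Finset κ) {cst : ↥B ⊕ ↥Ys → ℕ → Finset κ → ℝ} (hcst : ∀ τ m D', 0 ≤ cst τ m D') {a a' : ↥B → ℝ}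
    (hχ : ∀ (b : ↥B) (m : ℕ) (D' : Finset κ) (φ : {x : α // blk x ∈ X} → ℝ),
      |dset (fun j => Pi.single (q j) (1 : ℝ)) D' (fun ψ => uD χ p ek B Φ c Ys V t (Sum.inl b) m (ext blk X ψ)) φ| ≤
        cst (Sum.inl b) m D' * Set.indicator (Set.Icc (a b) (a' b)) (fun _ => (1 : ℝ)) |Φ b (ext blk X φ)|)
    (hY : ∀ (Y : ↥Ys) (m : ℕ) (D' : Finset κ) (φ : {x : α // blk x ∈ X} → ℝ),
      |dset (fun j => Pi.single (q j) (1 : ℝ)) D' (fun ψ => uD χ p ek B Φ c Ys V t (Sum.inr Y) m (ext blk X ψ)) φ| ≤ cst (Sum.inr Y) m D')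
    (φ : {x : α // blk x ∈ X} → ℝ) :
    |dset (fun j => Pi.single (q j) (1 : ℝ)) D (fun ψ => fD (uD χ p ek B Φ c Ys V t) cube γ K i (ext blk X ψ)) φ| ≤
      (∑ g ∈ Fintype.piFinset (fun j => if j ∈ D then univ.filter (fun τ => cube τ = i) else {τ₀}),
          ∏ τ ∈ univ.filter (fun τ => cube τ = i), cst τ (K.filter fun j => γ j = τ).card (D.filter fun j => g j = τ)) *
        Set.indicator {φ | ∀ b : ↥B, cube (Sum.inl b) = i → (K.filter fun j => γ j = Sum.inl b).card ≠ 0 →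
            a b ≤ |Φ b (ext blk X φ)| ∧ |Φ b (ext blk X φ)| ≤ a' b} (1 : ({x : α // blk x ∈ X} → ℝ) → ℝ) φ := by
  classical
  -- weights: the shell indicator on χ-slots, `1` on `V`-slots; selection: χ-slots differentiated in `t`
  let Sh : ↥B ⊕ ↥Ys → Set ({x : α // blk x ∈ X} → ℝ) :=
    fun τ => Sum.elim (fun b => {φ | a b ≤ |Φ b (ext blk X φ)| ∧ |Φ b (ext blk X φ)| ≤ a' b}) (fun _ => Set.univ) τ
  let w : ↥B ⊕ ↥Ys → ℕ → ({x : α // blk x ∈ X} → ℝ) → ℝ := fun τ _ φ => (Sh τ).indicator 1 φ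
  let P : ↥B ⊕ ↥Ys → Prop := fun τ => (∃ b : ↥B, τ = Sum.inl b) ∧ (K.filter fun j => γ j = τ).card ≠ 0
  have hcost : ∀ (τ : ↥B ⊕ ↥Ys) (m : ℕ) (D' : Finset κ) (φ : {x : α // blk x ∈ X} → ℝ),
      |dset (fun j => Pi.single (q j) (1 : ℝ)) D' (fun ψ => uD χ p ek B Φ c Ys V t τ m (ext blk X ψ)) φ| ≤ cst τ m D' * w τ m φ := by
    intro τ m D' φ
    rcases τ with b | Y
    · refine (hχ b m D' φ).trans (le_of_eq ?_)
      simp only [w, Sh, Sum.elim_inl]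
      by_cases hm : a b ≤ |Φ b (ext blk X φ)| ∧ |Φ b (ext blk X φ)| ≤ a' b
      · rw [Set.indicator_of_mem (show |Φ b (ext blk X φ)| ∈ Set.Icc (a b) (a' b) from hm),
          Set.indicator_of_mem (show φ ∈ {φ | a b ≤ |Φ b (ext blk X φ)| ∧ |Φ b (ext blk X φ)| ≤ a' b} from hm), Pi.one_apply]
      · rw [Set.indicator_of_notMem (show |Φ b (ext blk X φ)| ∉ Set.Icc (a b) (a' b) from hm),
          Set.indicator_of_notMem (show φ ∉ {φ | a b ≤ |Φ b (ext blk X φ)| ∧ |Φ b (ext blk X φ)| ≤ a' b} from hm)]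
    · refine (hY Y m D' φ).trans (le_of_eq ?_)
      simp only [w, Sh, Sum.elim_inr, Set.indicator_univ, Pi.one_apply, mul_one]
  have h := abs_dset_fD_uD_ext_le_of_slot_costs blk X χ p B Ys cube γ hek ht h1 hΦ hc hV K i τ₀ q D hcst
    (w := w) (fun τ _ φ => (indicator_one_mem_Icc _ _).1) (fun τ _ φ => (indicator_one_mem_Icc _ _).2) hcost P φ
  refine h.trans (le_of_eq ?_)
  congr 1
  -- the product of the kept weights is the indicator of the joint shell event
  rw [show (∏ τ ∈ (univ.filter (fun τ => cube τ = i)).filter P, w τ (K.filter fun j => γ j = τ).card φ) =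
      ∏ τ ∈ (univ.filter (fun τ => cube τ = i)).filter P, (Sh τ).indicator 1 φ from rfl, prod_indicator_one_eq_indicator_iInter]
  congr 1
  ext ψ
  simp only [Set.mem_iInter, mem_filter, mem_univ, true_and, Set.mem_setOf_eq, P]
  constructor
  · intro hall b hb hm
    exact hall (Sum.inl b) ⟨hb, ⟨b, rfl⟩, hm⟩
  · rintro hall τ ⟨hτ, ⟨b, rfl⟩, hm⟩
    exact hall b hτ hm

omit [DecidableEq ι] [DecidableEq υ] in
/-- **THE `V`-SLOT COST FROM ITS ALL-ORDERS LETTER** (p. 307 *"Functional derivatives hitting e^{−V^{(k)}(Y)} yield factors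
e^β(L^kε/ε₀)^{1/4−α}"*; r16's «§f typing gap #1»: the letter is a named hypothesis): if `‖Dⁿ[u_{Y,m}∘ext](ψ)‖ ≤ K(m,n)` for all `n, ψ`
(`u_{Y,m} = ∂_t^m e^{−tV_Y} = (−V_Y)^m e^{−tV_Y}`, smooth because `V_Y ∈ C_b^∞`) then `|∂_{q_{D′}}[u_{Y,m}∘ext](φ)| ≤ K(m,|D′|)` — the hypothesis
`hY` of `abs_dset_fD_uD_ext_le_indicator`. [cite: BalabanImbrieJaffe1988, §5.13 p.307, (5.14.3)–(5.14.4) p.309] -/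
theorem abs_dset_uD_inr_ext_le_of_letter [Fintype κ] (Y : ↥Ys) (hV : CbInf (V Y)) (m : ℕ) {KV : ℕ → ℝ}
    (hKV : ∀ (n : ℕ) (ψ : {x : α // blk x ∈ X} → ℝ),
      ‖iteratedFDeriv ℝ n (fun ψ : {x : α // blk x ∈ X} → ℝ => uD χ p ek B Φ c Ys V t (Sum.inr Y) m (ext blk X ψ)) ψ‖ ≤ KV n)
    (q : κ → {x : α // blk x ∈ X}) (D' : Finset κ) (φ : {x : α // blk x ∈ X} → ℝ) :
    |dset (fun j => Pi.single (q j) (1 : ℝ)) D' (fun ψ => uD χ p ek B Φ c Ys V t (Sum.inr Y) m (ext blk X ψ)) φ| ≤ KV D'.card := by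
  have h := (BIJ88SlotFactorsSmooth308.cbInf_uD_inr χ p B Ys (ek := ek) (Φ := Φ) (c := c) (t := t) Y hV m).comp_clm
    (BIJ88SmoothFactors5133.extCLM blk X)
  have hsm : CbInf fun ψ : {x : α // blk x ∈ X} → ℝ => uD χ p ek B Φ c Ys V t (Sum.inr Y) m (ext blk X ψ) := by
    refine (congrArg CbInf (funext fun ψ => ?_)).mp h
    rw [BIJ88SmoothFactors5133.extCLM_apply]
  exact BIJ88DsetNormBound306.abs_dset_single_le_of_bound q D' hsm.1 (B := fun n _ => KV n) (fun n ψ => hKV n ψ) φ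

end Literature.MathematicalPhysics.QuantumFieldTheory.BalabanImbrieJaffe1984to88.BIJ88CubeSlotCosts309
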